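import Literature.MathematicalPhysics.KineticTheory.HardSphereEulerProofs
import Mathlib.Probability.CentralLimitTheorem
import Mathlib.Probability.Independence.InfinitePi
import Mathlib.MeasureTheory.Measure.Portmanteau

/-!
# The canonical energy fluctuation has a Gaussian SIGN: kinetic-energy CLT under the local Gibbs law

Negative-lane tool for the crux `JParityClosure.LocalSecondLaw` (stmt-AtomisticToContinuum-13081), cycle 2 of the
standing disprover (`Cruxes/LocalSecondLaw/Disproof.lean` §(f), "missing input 2").  Under the homogeneous local Gibbs
law `(a₀, θ₀, u₀) = (1, Θ, 0)` the velocities are, conditionally on the positions, i.i.d. `N(0, Θ 𝟙)`; the mean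
kinetic energy `ke = (N+1)⁻¹ ∑ |vᵢ|²/2` therefore satisfies the central limit theorem, and in particular its deviation
from `3Θ/2` has an asymptotically Gaussian SIGN:

  `liminf_N P_N( ke − 3Θ/2 < a (N+1)^{-1/2} ) ≥ P(G < a) > 0`   for every `a ∈ ℝ`, `G ~ N(0, Var(|v|²/2))`

(`le_liminf_localGibbsLaw_ke_lt`, `gaussianReal_Iio_pos`).  With the sure bound
`I + init ≤ f_ex(σ³) + (ke − 3Θ/2)/Θ` of `Saturation.lean` this is the probabilistic half of the refutation of the
`η = 0` variant of the crux; the other half (saturation of the excess part to `o(N^{-1/2})`, a quantitative two-point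
cluster bound) is not in the tree.  Ingredients: Mathlib's CLT (`tendstoInDistribution_inv_sqrt_mul_sum_sub`) on the
i.i.d. model `Measure.infinitePi (fun _ : ℕ => gaussMeasure 0 Θ)`, the portmanteau lower bound for open sets, the
finite-dimensional marginal (`map_infinitePi_infinitePi_of_inj`, `infinitePi_eq_pi`) and the position/velocity
disintegration of the local Gibbs measure (`lintegral_localGibbsMeasure`).
refuter-cdisprove-stmt-AtomisticToContinuum-13081-g2-0.
-/

noncomputable section

namespace Summit.AtomisticToContinuum.HydrodynamicLimit.Theorems.LocalSecondLawNegative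

open MeasureTheory ProbabilityTheory Filter Set Topology
open scoped ENNReal NNReal
open Literature.MathematicalPhysics.KineticTheory Literature.Analysis.FluidPDE

/-! ## The one-particle observable and the i.i.d. model -/

/-- The centred one-particle kinetic energy `X(v) = |v|²/2 − 3Θ/2`. [folklore] -/
def Xe (Θ : ℝ) (v : V3) : ℝ := ‖v‖ ^ 2 / 2 - 3 / 2 * Θ

/-- `X` is continuous. [folklore] -/
theorem continuous_Xe (Θ : ℝ) : Continuous (Xe Θ) := by
  unfold Xe; fun_prop

/-- `X` is measurable. [folklore] -/
theorem measurable_Xe (Θ : ℝ) : Measurable (Xe Θ) := (continuous_Xe Θ).measurable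

/-- The i.i.d. model: countably many independent `N(0, Θ 𝟙)` velocities. [folklore] -/
def iidGauss (Θ : ℝ) : Measure (ℕ → V3) := Measure.infinitePi (fun _ : ℕ => gaussMeasure (0 : V3) Θ)

/-- The i.i.d. model is a probability measure (new instance on a new definition). [folklore] -/
instance isProbabilityMeasure_iidGauss (Θ : ℝ) : IsProbabilityMeasure (iidGauss Θ) := by
  unfold iidGauss; infer_instance

/-- The coordinate energies are independent. [folklore] -/
theorem iIndepFun_Xe (Θ : ℝ) : iIndepFun (fun k (ω : ℕ → V3) => Xe Θ (ω k)) (iidGauss Θ) :=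
  iIndepFun_infinitePi (P := fun _ : ℕ => gaussMeasure (0 : V3) Θ) (X := fun _ => Xe Θ)
    (fun _ => measurable_Xe Θ)

/-- The law of a coordinate energy is the image of `N(0, Θ 𝟙)` under `X`. [folklore] -/
theorem map_Xe_eval (Θ : ℝ) (k : ℕ) :
    (iidGauss Θ).map (fun ω => Xe Θ (ω k)) = (gaussMeasure (0 : V3) Θ).map (Xe Θ) := by
  have h : (fun ω : ℕ → V3 => Xe Θ (ω k)) = Xe Θ ∘ Function.eval k := rfl
  rw [h, ← Measure.map_map (measurable_Xe Θ) (measurable_pi_apply k)]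
  congr 1
  exact (measurePreserving_eval_infinitePi (fun _ : ℕ => gaussMeasure (0 : V3) Θ) k).map_eq

/-- The coordinate energies are identically distributed. [folklore] -/
theorem identDistrib_Xe (Θ : ℝ) (i : ℕ) :
    IdentDistrib (fun ω : ℕ → V3 => Xe Θ (ω i)) (fun ω => Xe Θ (ω 0)) (iidGauss Θ) (iidGauss Θ) where
  aemeasurable_fst := ((measurable_Xe Θ).comp (measurable_pi_apply i)).aemeasurable
  aemeasurable_snd := ((measurable_Xe Θ).comp (measurable_pi_apply 0)).aemeasurable
  map_eq := by rw [map_Xe_eval, map_Xe_eval]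

/-- The first coordinate energy has the one-particle law. [folklore] -/
theorem identDistrib_Xe_gauss (Θ : ℝ) :
    IdentDistrib (fun ω : ℕ → V3 => Xe Θ (ω 0)) (Xe Θ) (iidGauss Θ) (gaussMeasure (0 : V3) Θ) where
  aemeasurable_fst := ((measurable_Xe Θ).comp (measurable_pi_apply 0)).aemeasurable
  aemeasurable_snd := (measurable_Xe Θ).aemeasurable
  map_eq := by rw [map_Xe_eval]

/-- `X` is centred under `N(0, Θ 𝟙)`. [folklore] -/
theorem integral_Xe_gauss {Θ : ℝ} (hΘ : 0 < Θ) : ∫ v, Xe Θ v ∂gaussMeasure (0 : V3) Θ = 0 := by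
  have h := integral_energy_gaussMeasure (ι := Fin 3) (0 : V3) (θ := Θ) hΘ
  have hfun : (fun v : V3 => ‖v‖ ^ 2 / 2 - ‖(0 : V3)‖ ^ 2 / 2 - (Fintype.card (Fin 3) : ℝ) * Θ / 2) =
      Xe Θ := by
    funext v; simp [Xe]; ring
  rw [hfun] at h
  exact h

/-- `X ∈ L²` under `N(0, Θ 𝟙)`. [folklore] -/
theorem memLp_Xe_gauss (Θ : ℝ) : MemLp (Xe Θ) 2 (gaussMeasure (0 : V3) Θ) :=
  memLp_energy_gaussMeasure (0 : V3) Θ (3 / 2 * Θ)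

/-- The first coordinate energy is in `L²`. [folklore] -/
theorem memLp_Xe0 (Θ : ℝ) : MemLp (fun ω : ℕ → V3 => Xe Θ (ω 0)) 2 (iidGauss Θ) :=
  (identDistrib_Xe_gauss Θ).symm.memLp_snd (memLp_Xe_gauss Θ)

/-- The first coordinate energy is centred. [folklore] -/
theorem integral_Xe0 {Θ : ℝ} (hΘ : 0 < Θ) : (iidGauss Θ)[fun ω : ℕ → V3 => Xe Θ (ω 0)] = 0 := by
  rw [(identDistrib_Xe_gauss Θ).integral_eq]
  exact integral_Xe_gauss hΘ

/-- `N(0, Θ 𝟙)` charges the ball of radius `√Θ` (positive Maxwellian density). [folklore] -/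
theorem gaussMeasure_ball_ne_zero {Θ : ℝ} (hΘ : 0 < Θ) :
    gaussMeasure (0 : V3) Θ (Metric.ball 0 (Real.sqrt Θ)) ≠ 0 := by
  rw [← withDensity_localMaxwellian_eq_gaussMeasure hΘ (0 : V3), withDensity_apply _ measurableSet_ball]
  intro h0
  have hm : Measurable fun v : V3 => ENNReal.ofReal (localMaxwellian 1 Θ (0 : V3) v) :=
    (continuous_localMaxwellian 1 Θ (0 : V3)).measurable.ennreal_ofReal
  rw [lintegral_eq_zero_iff hm] at h0
  have hset : {v : V3 | (fun v => ENNReal.ofReal (localMaxwellian 1 Θ (0 : V3) v)) v ≠ (0 : V3 → ℝ≥0∞) v}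
      = Set.univ := by
    ext v
    simp only [Set.mem_setOf_eq, Pi.zero_apply, ne_eq, ENNReal.ofReal_eq_zero, not_le, Set.mem_univ,
      iff_true]
    exact localMaxwellian_pos one_pos hΘ _ _
  have h1 : (volume.restrict (Metric.ball (0 : V3) (Real.sqrt Θ))) Set.univ = 0 := by
    rw [← hset]
    exact h0
  rw [Measure.restrict_apply_univ] at h1
  exact (Metric.measure_ball_pos volume (0 : V3) (Real.sqrt_pos.2 hΘ)).ne' h1

/-- The one-particle energy has NON-ZERO variance under `N(0, Θ 𝟙)` (it is `≤ −Θ` on the ball of radius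
`√Θ`, which has positive Gaussian mass). [folklore] -/
theorem variance_Xe_gauss_ne_zero {Θ : ℝ} (hΘ : 0 < Θ) : Var[Xe Θ; gaussMeasure (0 : V3) Θ] ≠ 0 := by
  intro h0
  have hae := ae_eq_integral_of_variance_eq_zero (memLp_Xe_gauss Θ) h0
  rw [integral_Xe_gauss hΘ] at hae
  -- the ball is contained in `{X ≠ 0}`
  have hball : Metric.ball (0 : V3) (Real.sqrt Θ) ⊆ {v | Xe Θ v ≠ 0} := by
    intro v hv
    rw [Metric.mem_ball, dist_zero_right] at hv
    have h1 : ‖v‖ ^ 2 < Θ := by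
      have hs : Real.sqrt Θ ^ 2 = Θ := Real.sq_sqrt hΘ.le
      nlinarith [norm_nonneg v, Real.sqrt_nonneg Θ]
    show Xe Θ v ≠ 0
    unfold Xe
    intro h2
    nlinarith
  have hzero : gaussMeasure (0 : V3) Θ {v | Xe Θ v ≠ 0} = 0 := ae_iff.1 hae
  exact gaussMeasure_ball_ne_zero hΘ (measure_mono_null hball hzero)

/-- Non-zero variance in the i.i.d. model. [folklore] -/
theorem variance_Xe0_ne_zero {Θ : ℝ} (hΘ : 0 < Θ) : Var[fun ω : ℕ → V3 => Xe Θ (ω 0); iidGauss Θ] ≠ 0 := by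
  rw [(identDistrib_Xe_gauss Θ).variance_eq]
  exact variance_Xe_gauss_ne_zero hΘ

/-! ## The central limit theorem and the portmanteau lower bound -/

/-- The limit variance (as a non-negative real). [folklore] -/
def limVar (Θ : ℝ) : ℝ≥0 := (Var[fun ω : ℕ → V3 => Xe Θ (ω 0); iidGauss Θ]).toNNReal

/-- The limit variance is non-zero. [folklore] -/
theorem limVar_ne_zero {Θ : ℝ} (hΘ : 0 < Θ) : limVar Θ ≠ 0 := by
  unfold limVar
  intro h
  rw [Real.toNNReal_eq_zero] at h
  exact variance_Xe0_ne_zero hΘ (le_antisymm h (variance_nonneg _ _))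

/-- The normalised partial sums `(√n)⁻¹ ∑_{k<n} X(ω k)`. [folklore] -/
def Zn (Θ : ℝ) (n : ℕ) (ω : ℕ → V3) : ℝ := (Real.sqrt n)⁻¹ * ∑ k ∈ Finset.range n, Xe Θ (ω k)

/-- The normalised partial sums are measurable. [folklore] -/
theorem measurable_Zn (Θ : ℝ) (n : ℕ) : Measurable (Zn Θ n) := by
  unfold Zn
  refine measurable_const.mul (Finset.measurable_sum _ fun k _ => ?_)
  exact (measurable_Xe Θ).comp (measurable_pi_apply k)

/-- **CLT for the kinetic energy in the i.i.d. model**: `Zn ⇒ N(0, limVar)`. [folklore] -/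
theorem tendstoInDistribution_Zn {Θ : ℝ} (hΘ : 0 < Θ) :
    TendstoInDistribution (fun n ω => Zn Θ n ω) atTop (id : ℝ → ℝ) (fun _ => iidGauss Θ)
      (gaussianReal 0 (limVar Θ)) := by
  have hY : HasLaw (id : ℝ → ℝ) (gaussianReal 0 (Var[fun ω : ℕ → V3 => Xe Θ (ω 0); iidGauss Θ]).toNNReal)
      (gaussianReal 0 (limVar Θ)) := ⟨aemeasurable_id, Measure.map_id⟩
  have h := tendstoInDistribution_inv_sqrt_mul_sum_sub (X := fun k (ω : ℕ → V3) => Xe Θ (ω k))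
    (P := iidGauss Θ) hY (memLp_Xe0 Θ) (iIndepFun_Xe Θ) (identDistrib_Xe Θ)
  rw [integral_Xe0 hΘ] at h
  have hfun : (fun (n : ℕ) (ω : ℕ → V3) => (Real.sqrt n)⁻¹ *
      (∑ k ∈ Finset.range n, Xe Θ (ω k) - n * 0)) = fun n ω => Zn Θ n ω := by
    funext n ω; simp [Zn]
  rw [hfun] at h
  exact h

/-- **Portmanteau**: the liminf of the probabilities of `{Zn < a}` is at least the Gaussian mass of `(-∞, a)`.
[folklore] -/
theorem le_liminf_iidGauss_Zn_lt {Θ : ℝ} (hΘ : 0 < Θ) (a : ℝ) :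
    gaussianReal 0 (limVar Θ) (Iio a) ≤ liminf (fun n => iidGauss Θ {ω | Zn Θ n ω < a}) atTop := by
  have h := tendstoInDistribution_Zn hΘ
  have hl := ProbabilityMeasure.le_liminf_measure_open_of_tendsto h.tendsto (G := Iio a) isOpen_Iio
  simp only [ProbabilityMeasure.coe_mk, Measure.map_id] at hl
  refine hl.trans (le_of_eq ?_)
  refine liminf_congr (Eventually.of_forall fun n => ?_)
  rw [Measure.map_apply (measurable_Zn Θ n) measurableSet_Iio]
  rfl

/-- The Gaussian mass of a half-line is positive (non-degenerate variance). [folklore] -/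
theorem gaussianReal_Iio_pos {v : ℝ≥0} (hv : v ≠ 0) (a : ℝ) : 0 < gaussianReal 0 v (Iio a) := by
  have hac := gaussianReal_absolutelyContinuous' 0 hv
  refine pos_iff_ne_zero.2 fun h0 => ?_
  have h1 : (volume : Measure ℝ) (Iio a) = 0 := hac h0
  simp at h1

/-! ## From the i.i.d. model to the finite products and to the local Gibbs law -/

/-- The event `{∑_{i<n} X(vᵢ) < a √n}` on `n` velocities. [folklore] -/
def sumEvent (Θ : ℝ) (n : ℕ) (a : ℝ) : Set (Fin n → V3) :=
  {v | ∑ i, Xe Θ (v i) < a * Real.sqrt n}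

/-- The sum event is measurable. [folklore] -/
theorem measurableSet_sumEvent (Θ : ℝ) (n : ℕ) (a : ℝ) : MeasurableSet (sumEvent Θ n a) := by
  unfold sumEvent
  refine measurableSet_lt (Finset.measurable_sum _ fun i _ => ?_) measurable_const
  exact (measurable_Xe Θ).comp (measurable_pi_apply i)

/-- **Finite-dimensional marginal**: the i.i.d. model's probability of `{Zn < a}` is the `n`-fold product
Gaussian probability of `sumEvent`. [folklore] -/
theorem iidGauss_Zn_lt_eq {Θ : ℝ} (n : ℕ) (hn : 0 < n) (a : ℝ) :
    iidGauss Θ {ω | Zn Θ n ω < a} =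
      Measure.pi (fun _ : Fin n => gaussMeasure (0 : V3) Θ) (sumEvent Θ n a) := by
  have hproj : (iidGauss Θ).map (fun (ω : ℕ → V3) (i : Fin n) => ω (i : ℕ)) =
      Measure.pi (fun _ : Fin n => gaussMeasure (0 : V3) Θ) := by
    unfold iidGauss
    rw [Measure.map_infinitePi_infinitePi_of_inj (P := fun _ : ℕ => gaussMeasure (0 : V3) Θ)
      (f := fun i : Fin n => (i : ℕ)) Fin.val_injective, Measure.infinitePi_eq_pi]
  have hmeas : Measurable (fun (ω : ℕ → V3) (i : Fin n) => ω (i : ℕ)) :=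
    measurable_pi_lambda _ fun i => measurable_pi_apply _
  rw [← hproj, Measure.map_apply hmeas (measurableSet_sumEvent Θ n a)]
  congr 1
  ext ω
  simp only [Set.mem_setOf_eq, Set.mem_preimage, sumEvent, Zn]
  rw [Fin.sum_univ_eq_sum_range (fun k => Xe Θ (ω k)) n]
  have hs : 0 < Real.sqrt n := Real.sqrt_pos.2 (by exact_mod_cast hn)
  rw [inv_mul_lt_iff₀ hs]
  constructor <;> intro h <;> linarith [mul_comm a (Real.sqrt n)]

/-- **Velocity-only events under the local Gibbs law**: for the homogeneous profiles `(1, Θ, 0)` the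
probability of an event depending only on the velocities is its product-Gaussian probability
(position/velocity disintegration; the velocity law does not depend on the positions). [folklore] -/
theorem localGibbsMeasure_vel_event {σ Θ : ℝ} (hΘ : 0 < Θ) (hσ : σ ≤ 1 / 2) (N : ℕ)
    {E : Set (Fin (N + 1) → V3)} (hE : MeasurableSet E) :
    localGibbsMeasure σ (fun _ => 1) (fun _ => 0) (fun _ => Θ) N {z | (fun i => (z i).2) ∈ E} =
      Measure.pi (fun _ : Fin (N + 1) => gaussMeasure (0 : V3) Θ) E := by
  have hc1 : Continuous (fun _ : T3 => (1 : ℝ)) := continuous_const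
  have hcΘ : Continuous (fun _ : T3 => Θ) := continuous_const
  have hc0 : Continuous (fun _ : T3 => (0 : V3)) := continuous_const
  haveI := isProbabilityMeasure_localGibbsMeasure (u₀ := fun _ => (0 : V3)) hc1 hcΘ hc0
    (fun _ => one_pos) (fun _ => hΘ) hσ N
  set A : Set (Config (N + 1) (Fin 3) T3) := {z | (fun i => (z i).2) ∈ E} with hA
  have hvm : Measurable fun z : Config (N + 1) (Fin 3) T3 => fun i => (z i).2 :=
    measurable_pi_lambda _ fun i => (measurable_pi_apply i).snd
  have hAm : MeasurableSet A := hvm hE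
  have hvel : ∀ x : Fin (N + 1) → T3,
      velMeasure (fun _ => (0 : V3)) (fun _ => Θ) x {v | zipConfig (x, v) ∈ A} =
        Measure.pi (fun _ : Fin (N + 1) => gaussMeasure (0 : V3) Θ) E := by
    intro x
    have hset : {v : Fin (N + 1) → V3 | zipConfig (x, v) ∈ A} = E := by
      ext v
      simp [hA]
    rw [hset]
    rfl
  calc localGibbsMeasure σ (fun _ => 1) (fun _ => 0) (fun _ => Θ) N A
      = ∫⁻ z, A.indicator 1 z ∂localGibbsMeasure σ (fun _ => 1) (fun _ => 0) (fun _ => Θ) N :=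
        (lintegral_indicator_one hAm).symm
    _ = ∫⁻ x, ENNReal.ofReal ((canonicalPartition (Torus.geometry (Fin 3)) (hsDiameter σ N)
          (N + 1) (localGibbsProfile (fun _ => 1) (fun _ => 0) (fun _ => Θ)))⁻¹ *
            posWeight (fun _ => 1) (hsDiameter σ N) (N + 1) x) *
          velMeasure (fun _ => (0 : V3)) (fun _ => Θ) x {v | zipConfig (x, v) ∈ A} := by
        rw [lintegral_localGibbsMeasure hc1 hcΘ hc0 (fun _ => zero_le_one) (fun _ => hΘ) σ N
          (measurable_one.indicator hAm)]
        refine lintegral_congr fun x => ?_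
        congr 1
        have hpre : MeasurableSet {v : Fin (N + 1) → V3 | zipConfig (x, v) ∈ A} :=
          hAm.preimage (measurable_zipConfig.comp (measurable_const.prodMk measurable_id))
        rw [← lintegral_indicator_one hpre]
        rfl
    _ = ∫⁻ x, ENNReal.ofReal ((canonicalPartition (Torus.geometry (Fin 3)) (hsDiameter σ N)
          (N + 1) (localGibbsProfile (fun _ => 1) (fun _ => 0) (fun _ => Θ)))⁻¹ *
            posWeight (fun _ => 1) (hsDiameter σ N) (N + 1) x) *
          Measure.pi (fun _ : Fin (N + 1) => gaussMeasure (0 : V3) Θ) E := by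
        simp_rw [hvel]
    _ = Measure.pi (fun _ : Fin (N + 1) => gaussMeasure (0 : V3) Θ) E := by
        have hρm : Measurable fun x : Fin (N + 1) → T3 => ENNReal.ofReal
            ((canonicalPartition (Torus.geometry (Fin 3)) (hsDiameter σ N) (N + 1)
              (localGibbsProfile (fun _ => 1) (fun _ => 0) (fun _ => Θ)))⁻¹ *
              posWeight (fun _ => 1) (hsDiameter σ N) (N + 1) x) :=
          (measurable_const.mul (measurable_posWeight hc1 _ _)).ennreal_ofReal
        rw [lintegral_mul_const _ hρm, lintegral_posWeight_eq_one hc1 hcΘ hc0 (fun _ => zero_le_one)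
          (fun _ => hΘ) σ N, one_mul]

/-- The mean kinetic energy `(N+1)⁻¹ ∑ |vᵢ|²/2` of a configuration (same body as `Functional.ke`). [folklore] -/
def keC {N : ℕ} (w : Config (N + 1) (Fin 3) T3) : ℝ :=
  ((N + 1 : ℕ) : ℝ)⁻¹ * ∑ i, ‖(w i).2‖ ^ 2 / 2

/-- The energy-deficit event `{ke − 3Θ/2 < a (N+1)^{-1/2}}` is the velocity event `sumEvent`. [folklore] -/
theorem setOf_keC_lt_eq {Θ : ℝ} (N : ℕ) (a : ℝ) :
    {z : Config (N + 1) (Fin 3) T3 | keC z - 3 / 2 * Θ < a * (Real.sqrt (N + 1 : ℕ))⁻¹} =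
      {z | (fun i => (z i).2) ∈ sumEvent Θ (N + 1) a} := by
  ext z
  simp only [Set.mem_setOf_eq, sumEvent, Xe, keC]
  rw [Finset.sum_sub_distrib, Finset.sum_const, Finset.card_univ, Fintype.card_fin, nsmul_eq_mul]
  set n : ℝ := ((N + 1 : ℕ) : ℝ) with hn'
  set S : ℝ := ∑ i, ‖(z i).2‖ ^ 2 / 2 with hS
  have hN : 0 < n := by rw [hn']; positivity
  have hn0 : n ≠ 0 := hN.ne'
  have hs : 0 < Real.sqrt n := Real.sqrt_pos.2 hN
  have hs0 : Real.sqrt n ≠ 0 := hs.ne'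
  have hsq : Real.sqrt n * Real.sqrt n = n := Real.mul_self_sqrt hN.le
  have h1 : a * (Real.sqrt n)⁻¹ = (a * Real.sqrt n) / n := by
    rw [eq_div_iff hn0]
    calc a * (Real.sqrt n)⁻¹ * n = a * (Real.sqrt n)⁻¹ * (Real.sqrt n * Real.sqrt n) := by rw [hsq]
      _ = a * Real.sqrt n := by field_simp
  have h2 : n⁻¹ * S - 3 / 2 * Θ = (S - n * (3 / 2 * Θ)) / n := by
    field_simp
  rw [h1, h2, div_lt_div_iff_of_pos_right hN]

/-- **The kinetic-energy CLT under the local Gibbs law (liminf form).**  For the homogeneous local Gibbs data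
`(1, Θ, 0)`, `Θ > 0`, `σ ≤ 1/2`, every flow family and every `a ∈ ℝ`:

  `P(G < a) ≤ liminf_N P_N( ke − 3Θ/2 < a (N+1)^{-1/2} )`,  `G ~ N(0, limVar Θ)`, `limVar Θ ≠ 0`,

so the deficit event `{ke < 3Θ/2 − |a| (N+1)^{-1/2}}` keeps probability `≥ P(G < −|a|) > 0` — the canonical energy
fluctuation has an asymptotically symmetric, non-degenerate sign. [folklore] -/
theorem le_liminf_localGibbsLaw_ke_lt {σ Θ : ℝ} (hΘ : 0 < Θ) (hσ : σ ≤ 1 / 2)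
    (Φ : (N : ℕ) → HardSphereFlow (Torus.geometry (Fin 3)) (hsDiameter σ N) (N + 1)) (a : ℝ) :
    gaussianReal 0 (limVar Θ) (Iio a) ≤
      liminf (fun N => localGibbsLaw σ (fun _ => 1) (fun _ => 0) (fun _ => Θ) N (Φ N)
        {z | keC z - 3 / 2 * Θ < a * (Real.sqrt (N + 1 : ℕ))⁻¹}) atTop := by
  have h1 := le_liminf_iidGauss_Zn_lt hΘ a
  -- identify the two sequences along `n = N + 1`
  have hident : ∀ N : ℕ, localGibbsLaw σ (fun _ => 1) (fun _ => 0) (fun _ => Θ) N (Φ N)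
      {z | keC z - 3 / 2 * Θ < a * (Real.sqrt (N + 1 : ℕ))⁻¹} = iidGauss Θ {ω | Zn Θ (N + 1) ω < a} := by
    intro N
    rw [localGibbsLaw_eq, setOf_keC_lt_eq, localGibbsMeasure_vel_event hΘ hσ N (measurableSet_sumEvent Θ _ a),
      iidGauss_Zn_lt_eq (N + 1) (Nat.succ_pos N) a]
  simp_rw [hident]
  rw [Filter.liminf_nat_add (fun n => iidGauss Θ {ω | Zn Θ n ω < a}) 1]
  exact h1

end Summit.AtomisticToContinuum.HydrodynamicLimit.Theorems.LocalSecondLawNegative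

end
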